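import Summits.BirchSwinnertonDyer.BirchSwinnertonDyer.Theorems.EisensteinDepletionAtTwoStarOptBSFShimuraExponentLemmas
import Summits.BirchSwinnertonDyer.BirchSwinnertonDyer.Theorems.EisensteinDepletionAtTwoStarOptBSFPositions
import Summits.BirchSwinnertonDyer.BirchSwinnertonDyer.Theorems.EisensteinDepletionAtTwoStarOptBSFOddCover
import Summits.BirchSwinnertonDyer.BirchSwinnertonDyer.Theorems.EisensteinDepletionAtTwoStarOptBNSFStubTwoPowerWalk
import Summits.BirchSwinnertonDyer.BirchSwinnertonDyer.Theorems.EisensteinDepletionAtTwoStarOptBNSFStubIsogenyFactor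
import HarnessLib

/-!
# Line `star` on crux E1M (stmt-BirchSwinnertonDyer-20341), even-index residue `stub_starOptBSFEven`:
# THE SHIMURA-EXPONENT DOOR — when `[Λ_f : Λ₁(f)]` has 2-part ≤ 2, the stub needs only (T1)

Lead star-p1 GEN 16.  GEN 15 reduced the squarefree residue of E1M to two POSITION LAWS of the `X₀(N)`-lattice-optimal curve `W₀`
(`SfPositions.starOptBSF_of_positions`): (T1) «unique rational 2-torsion + formal ⇒ odd» and (T2) «no formal-AND-odd rational
abscissa on `W₀` in a habitat class, `N ≠ 15`».  THIS FILE removes (T2) whenever the SHIMURA EXPONENT is `2 × odd`, i.e. there is an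
odd `d` with `2d·Λ_f ⊆ Λ₁(f)` — which holds at every level `N = pq`, `p ≡ q ≡ 3 (mod 4)` (`ShimuraExp.exists_odd_two_mul_nsmul_mem_periodLatticeGamma1`:
`Λ_f/Λ₁(f)` is a quotient of `(ℤ/N)ˣ`, whose exponent is then `2 × odd`), the levels of 22 of the 27 even-index habitat classes
`N < 5·10⁵` (all of the form `N = pq` with `q^β − p^α = ±16` or `p^α + q^β = 16`; memo Lines/star-even-structure-gen16.md).

MECHANISM (all tree theorems, modulo the three prints Modularity / CES–Stevens `Γ₁(N)`-datum / unbounded denominators):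
let `W₁` be the `X₁(N)`-type curve of the class (Néron lattice `c₁Λ₁(f)`, `c₁ ∈ ℤ`, `NsfDoorPrint.x1OptimalInt_of_print`); it has NO
formal rational 2-torsion (Stevens at 2, `StevensAllLevels.stevensAtTwoX1Int_allLevels`), hence a unique rational 2-torsion abscissa,
which is ODD (regime transport from the habitat curve, `NsfReduction.regimeTransport`).  The Shimura isogeny `ψ : W₁ → W₀` of the lattice
inclusion `(q/c₁)Λ_{W₁} ⊆ Λ_{W₀}` has kernel killed by `2d` (`ShimuraExp.exists_isogeny_nsmul_ker_eq_zero_of_isNeronLatticeOf`); write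
`ψ = λ ∘ [2^j]` with `W₁[2] ⊄ ker λ` (`Walk.exists_eq_comp_twoPow_nsmul`).  Either `ker λ` has no point of order 2 — then `λ` and its dual
have odd degree and `W₀` has no formal point either (odd transport), so regime transport concludes — or it has exactly one, `Q`, rational,
the unique (étale, odd) rational 2-torsion point of `W₁`; the 2-isogeny step through `Q` (`Walk.twoIsogenyStep`) lands on `V` whose dual point
`s₁` is FORMAL and EVEN (flip laws), `λ = λ₁ ∘ π` with `deg λ₁` odd (its kernel is killed by `d`), and the image of `s₁` on `W₀` is a rational
abscissa `x'` that is formal and even (pointwise odd transport).  By (T1) the rational 2-torsion of `W₀` is then not unique, and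
`SfPositions.exists_odd_etale_of_two_rat` gives the odd étale abscissa.  So the configuration «MID-pointed optimal centre» (15a1) needs
`4 ∣ [Λ_f : Λ₁(f)]`, impossible when `(ℤ/N)ˣ` has exponent `2 × odd`.

* `odd_degree_of_ker_nsmul`, `exists_odd_dual` — degree bookkeeping;
* `starOptBSF_of_shimuraExpTwo_of_T1` — THE DOOR: prints + `2d·Λ_f ⊆ Λ₁(f)` (`d` odd) + (T1) for this `W₀` ⇒ the stub's conclusion;
* `starOptBSF_pq3_of_T1` — the instance `N = pq`, `p ≡ q ≡ 3 (mod 4)` (conductor of the habitat curve), from prints + (T1) alone.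

CONDITIONAL on the prints and on (T1) (stated inline, verbatim as in `SfPositions`); no `sorry`, no new definition; nothing here reads
`r_an`; StarOptB / E1M / BSD are NOT proved by this file.
-/

set_option linter.dupNamespace false
set_option autoImplicit false

noncomputable section

open scoped Classical
open WeierstrassCurve Literature.NumberTheory.EllipticCurves Literature.NumberTheory.EllipticCurves.Greenberg1999
open Literature.NumberTheory.EllipticCurves.ModularForms
open Summit.BirchSwinnertonDyer.BirchSwinnertonDyer.Theorems.DepletionAtTwo
open Summit.BirchSwinnertonDyer.BirchSwinnertonDyer.Theorems.DepletionAtTwo.Walk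
open Summit.BirchSwinnertonDyer.BirchSwinnertonDyer.Theorems.DepletionAtTwo.OddTransportRamified
open Summit.BirchSwinnertonDyer.BirchSwinnertonDyer.Theorems.DepletionAtTwo.ArchTransport

namespace Summit.BirchSwinnertonDyer.BirchSwinnertonDyer.Theorems.DepletionAtTwo.SfShimuraExp

/-! ### Degree bookkeeping -/

/-- An isogeny whose kernel is killed by an odd `d` has odd degree (no kernel element of order `2`). [cite: SilvermanAEC2009, III.4.10] -/
theorem odd_degree_of_ker_nsmul {A B : WeierstrassCurve ℚ} (φ : Isogeny A B) {d : ℕ} (hd : Odd d)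
    (h : ∀ P : A.geomPoints, φ P = 0 → d • P = 0) : Odd φ.degree := by
  unfold Isogeny.degree
  refine EisensteinDepletionAtTwoStarOptBNSFStubIsogenyFactor.odd_natCard_of_forall_addOrderOf_ne_two fun g hg ↦ ?_
  have hkill : d • (g : A.geomPoints) = 0 := h g ((AddMonoidHom.mem_ker).mp g.2)
  have hdvd : addOrderOf (g : A.geomPoints) ∣ d := addOrderOf_dvd_of_nsmul_eq_zero hkill
  rw [AddSubgroup.addOrderOf_coe, hg] at hdvd
  exact (Nat.not_even_iff_odd.mpr hd) (even_iff_two_dvd.mpr hdvd)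

/-- The dual of an odd-degree isogeny of elliptic curves has odd degree (its kernel is killed by the odd degree).
[cite: SilvermanAEC2009, Thm. III.6.1(a)] -/
theorem exists_odd_dual {A B : WeierstrassCurve ℚ} [A.IsElliptic] [B.IsElliptic] (φ : Isogeny A B) (hodd : Odd φ.degree) :
    ∃ μ : Isogeny B A, Odd μ.degree := by
  obtain ⟨μ, hμ⟩ := Isogeny.exists_dual_elliptic_holds (W := A) (W' := B) φ
  refine ⟨μ, odd_degree_of_ker_nsmul μ hodd fun Q hQ ↦ ?_⟩
  obtain ⟨R, rfl⟩ := φ.surjective Q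
  have hR : (φ.degree : ℤ) • R = 0 := by rw [← hμ R, hQ]
  have hR' : φ.degree • R = 0 := by rwa [natCast_zsmul] at hR
  rw [← map_nsmul, hR', map_zero]

/-! ### The door -/

/-- **THE SHIMURA-EXPONENT DOOR.**  Prints (Modularity, CES/Stevens `Γ₁(N)`-datum, UBD) + «`2d·Λ_f ⊆ Λ₁(f)` for some odd `d`» + (T1) for
the lattice-optimal curve `W₀` of a habitat class ⇒ `W₀` has a rational 2-torsion abscissa that is ODD and NOT ramified at 2 (see the
module docstring for the mechanism).  CONDITIONAL on the prints and (T1).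
[cite: Stevens1989, §2] [cite: GreenbergLNM1716, §5 Props. 5.13–5.14 (pp. 120–121)] [cite: CalegariDimitrovTang2025, Thm. 1.0.1]
[cite: Watkins2002, Lemma 3.1] -/
theorem starOptBSF_of_shimuraExpTwo_of_T1 (hnf : exists_isNewformOf) (hex : exists_optimal_gamma1ParametrizationData)
    (hU : Literature.NumberTheory.Automorphic.CalegariDimitrovTang2025_unboundedDenominators) :
    ∀ (W : WeierstrassCurve ℚ) [W.IsElliptic] [W.IsGloballyMinimal] (x : ℚ), IsOrdinaryAt W 2 →
      HasUniqueRationalTwoTorsionX W x →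
      ((TwoTorsionRamifiedAtTwo x ∧ ¬ TwoTorsionOdd W x) ∨ (TwoTorsionOdd W x ∧ ¬ TwoTorsionRamifiedAtTwo x)) →
      ∀ ⦃N : ℕ⦄ [NeZero N] (f : CuspForm (CongruenceSubgroup.Gamma0 N) 2), IsNewformOf W f →
      (∃ d : ℕ, Odd d ∧ ∀ w ∈ periodLattice f, ((2 * d : ℕ) : ℂ) * w ∈ periodLatticeGamma1 f) →
      ∀ (W₀ : WeierstrassCurve ℚ) [W₀.IsElliptic] [W₀.IsGloballyMinimal], IsNewformOf W₀ f →
      ∀ (L₀ : PeriodPair), IsNeronLatticeOf (W₀.baseChange ℂ) L₀ → ∀ (q : ℚ), q ≠ 0 →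
      (∀ z ∈ periodLattice f, (q : ℂ) * z ∈ L₀.lattice) → (∀ z ∈ L₀.lattice, ∃ w ∈ periodLattice f, z = (q : ℂ) * w) →
      (∀ x₀ : ℚ, HasUniqueRationalTwoTorsionX W₀ x₀ → TwoTorsionRamifiedAtTwo x₀ → TwoTorsionOdd W₀ x₀) →
      ∃ x₀ : ℚ, HasRationalTwoTorsionX W₀ x₀ ∧ TwoTorsionOdd W₀ x₀ ∧ ¬ TwoTorsionRamifiedAtTwo x₀ := by
  intro W _ _ x hord hux htype N _ f hW hexp W₀ _ _ hW₀ L₀ hL₀ q hq hin hout hT1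
  obtain ⟨d, hd, hdΛ⟩ := hexp
  have hiso : WeierstrassCurve.IsIsogenous W W₀ :=
    IsNewformOf.isIsogenous WeierstrassCurve.isIsogenous_iff_frobeniusTrace_eq_holds hW hW₀
  have hord₀ : IsOrdinaryAt W₀ 2 := IsogenyMuShift.isOrdinaryAt_of_isIsogenous hiso hord
  by_cases hno : ¬ ∃ x₀ : ℚ, HasRationalTwoTorsionX W₀ x₀ ∧ TwoTorsionRamifiedAtTwo x₀
  · exact NsfReduction.regimeTransport W x hord hux htype W₀ hiso hno
  push Not at hno
  obtain ⟨xf, hxf, hRf⟩ := hno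
  -- the `X₁(N)`-type curve `W₁` of the class, Stevens at 2, and its unique (odd, étale) rational 2-torsion point
  obtain ⟨W₁, _i₁, _i₂, L₁, c₁, hW₁, hL₁, hc₁, hint, hin₁, hout₁⟩ := NsfDoorPrint.x1OptimalInt_of_print hnf hex W₀ f hW₀
  have hS : ∀ x₁ : ℚ, HasRationalTwoTorsionX W₁ x₁ → ¬ TwoTorsionRamifiedAtTwo x₁ := fun x₁ hx₁ ↦
    StevensAllLevels.stevensAtTwoX1Int_allLevels hU W₁ f hW₁ L₁ hL₁ c₁ hc₁ hin₁ hout₁ hint x₁ hx₁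
  have hiso₁ : WeierstrassCurve.IsIsogenous W W₁ :=
    IsNewformOf.isIsogenous WeierstrassCurve.isIsogenous_iff_frobeniusTrace_eq_holds hW hW₁
  have hord₁ : IsOrdinaryAt W₁ 2 := IsogenyMuShift.isOrdinaryAt_of_isIsogenous hiso₁ hord
  have hno₁ : ¬ ∃ x₁ : ℚ, HasRationalTwoTorsionX W₁ x₁ ∧ TwoTorsionRamifiedAtTwo x₁ := by
    rintro ⟨x₁, hx₁, hr⟩; exact hS x₁ hx₁ hr
  -- the Shimura isogeny `ψ : W₁ → W₀` with kernel killed by `2d`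
  have hc₁C : (c₁ : ℂ) ≠ 0 := by exact_mod_cast hc₁
  have hqC : (q : ℂ) ≠ 0 := by exact_mod_cast hq
  have hcq : q / c₁ ≠ 0 := div_ne_zero hq hc₁
  have hle : ∀ z ∈ L₁.lattice, ((q / c₁ : ℚ) : ℂ) * z ∈ L₀.lattice := by
    intro z hz
    obtain ⟨w, hw, rfl⟩ := hout₁ z hz
    have h1 : ((q / c₁ : ℚ) : ℂ) * ((c₁ : ℂ) * w) = (q : ℂ) * w := by push_cast; field_simp
    rw [h1]
    exact hin w (periodLatticeGamma1_le_periodLattice f hw)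
  have hkill : ∀ z : ℂ, ((q / c₁ : ℚ) : ℂ) * z ∈ L₀.lattice → ((2 * d : ℕ) : ℂ) * z ∈ L₁.lattice := by
    intro z hz
    obtain ⟨w, hw, hzw⟩ := hout _ hz
    have h1 : z = (c₁ : ℂ) * w := by
      push_cast at hzw
      rw [div_mul_eq_mul_div, div_eq_iff hc₁C] at hzw
      exact mul_left_cancel₀ hqC (hzw.trans (by ring))
    rw [h1, mul_left_comm]
    exact hin₁ _ (hdΛ w hw)
  obtain ⟨ψ, hψkill, -⟩ := ShimuraExp.exists_isogeny_nsmul_ker_eq_zero_of_isNeronLatticeOf W₁ W₀ hL₁ hL₀ hcq hle hkill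
  -- `ψ = λ ∘ [2^j]`, `W₁[2] ⊄ ker λ`, `ker λ` killed by `2d`
  obtain ⟨j, lam, hlam, P₀, hP₀2, hlamP₀⟩ := exists_eq_comp_twoPow_nsmul ψ
  have hP₀0 : P₀ ≠ 0 := fun h ↦ hlamP₀ (by rw [h, map_zero])
  have hlamkill : ∀ Q : W₁.geomPoints, lam Q = 0 → (2 * d) • Q = 0 := by
    intro Q hQ
    obtain ⟨R, hR⟩ := (Isogeny.nsmul W₁ (2 ^ j) (pow_ne_zero j two_ne_zero)).surjective Q
    rw [Isogeny.nsmul_apply] at hR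
    subst hR
    have hψR : ψ R = 0 := by rw [hlam]; exact hQ
    rw [← mul_nsmul', mul_comm, mul_nsmul', hψkill R hψR, nsmul_zero]
  by_cases hex2 : ∃ Q : W₁.geomPoints, Q ≠ 0 ∧ Q + Q = 0 ∧ lam Q = 0
  swap
  · -- no kernel point of order 2: `λ` (and its dual) have odd degree, so `W₀` has no formal point either
    push Not at hex2
    have hoddlam : Odd lam.degree := by
      refine odd_degree_of_ker_nsmul lam hd fun Q hQ ↦ ?_
      have hdQ : lam (d • Q) = 0 := by rw [map_nsmul, hQ, nsmul_zero]
      have h2dQ : d • Q + d • Q = 0 := by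
        rw [← add_nsmul, ← two_mul]; exact hlamkill Q hQ
      by_contra hne
      exact hex2 (d • Q) hne h2dQ hdQ
    obtain ⟨μ, hμ⟩ := exists_odd_dual lam hoddlam
    obtain ⟨x₁, hx₁, hr₁⟩ := exists_ramified_twoTorsion_of_isogeny_of_odd μ hμ hord₀ hxf hRf
    exact absurd hr₁ (hS x₁ hx₁)
  obtain ⟨Q, hQ0, hQ2, hlamQ⟩ := hex2
  -- `Q` is the only kernel point of order 2, hence rational
  have honly : ∀ R : W₁.geomPoints, R + R = 0 → lam R = 0 → R = 0 ∨ R = Q := fun R hR2 hlamR ↦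
    eq_zero_or_eq_of_ker lam hQ2 hP₀2 hR2 hQ0 hP₀0 hlamQ hlamP₀ hlamR
  have hQfix : ∀ σ : Field.absoluteGaloisGroup ℚ, σ • Q = Q := by
    intro σ
    have hσ2 : σ • Q + σ • Q = 0 := by rw [← smul_add, hQ2, smul_zero]
    have hσlam : lam (σ • Q) = 0 := by rw [lam.map_smul, hlamQ, smul_zero]
    rcases honly (σ • Q) hσ2 hσlam with h | h
    · exact absurd (MulAction.injective σ (h.trans (smul_zero σ).symm)) hQ0
    · exact h
  obtain ⟨s, ys, hPs, hSeq, hys⟩ := exists_eq_toGeomPoints_of_two_torsion (E := W₁) hQ0 hQ2 hQfix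
  have hs : HasRationalTwoTorsionX W₁ s := hasRationalTwoTorsionX_of_nonsingular hPs hys
  have hu₁ : HasUniqueRationalTwoTorsionX W₁ s := TwoAdic.hasUniqueRationalTwoTorsionX_of_forall_not_ramified_rat W₁ hord₁.1 hS hs
  -- `Q` is odd (regime transport to `W₁`) and étale (Stevens)
  have hso : TwoTorsionOdd W₁ s := by
    obtain ⟨x₁, hx₁, ho₁, -⟩ := NsfReduction.regimeTransport W x hord hux htype W₁ hiso₁ hno₁
    rwa [hu₁.2 x₁ hx₁] at ho₁
  have hsR : ¬ TwoTorsionRamifiedAtTwo s := hS s hs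
  -- the 2-isogeny step through `Q`
  obtain ⟨V, hV, hVmin, π, s₁, y₁, hP₁, hy₁, hkerπ, -, hedge⟩ := twoIsogenyStep W₁ hPs hys
  haveI := hV
  haveI := hVmin
  have hordV : IsOrdinaryAt V 2 := IsogenyMuShift.isOrdinaryAt_of_isIsogenous ⟨π⟩ hord₁
  obtain ⟨hRflip, hOflip⟩ := hedge (Or.inl hord₁) (Or.inl hordV)
  have hs₁R : TwoTorsionRamifiedAtTwo s₁ := by
    by_contra h
    exact hsR (hRflip.mpr h)
  have hs₁O : ¬ TwoTorsionOdd V s₁ := hOflip.mp hso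
  -- factor `λ = λ₁ ∘ π`, `deg λ₁` odd
  have hsep : π.deg ≤ Nat.card π.toAddMonoidHom.ker := le_of_eq (Isogeny.degree_eq_deg π).symm
  have hkerle : ∀ R : W₁.geomPoints, π R = 0 → lam R = 0 := by
    intro R hR
    rcases (hkerπ R).mp hR with h | h
    · rw [h, map_zero]
    · rw [h, ← hSeq, hlamQ]
  obtain ⟨lam₁, hlam₁⟩ := π.exists_eq_comp_of_ker_le lam hsep hkerle
  have hπQ : π Q = 0 := (hkerπ Q).mpr (Or.inr hSeq)
  have hodd₁ : Odd lam₁.degree := by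
    refine odd_degree_of_ker_nsmul lam₁ hd fun P hP ↦ ?_
    obtain ⟨R, rfl⟩ := π.surjective P
    have hlamR : lam R = 0 := by rw [hlam₁]; exact hP
    have hdR2 : d • R + d • R = 0 := by
      rw [← add_nsmul, ← two_mul]; exact hlamkill R hlamR
    have hdRlam : lam (d • R) = 0 := by rw [map_nsmul, hlamR, nsmul_zero]
    rw [← map_nsmul]
    rcases honly (d • R) hdR2 hdRlam with h | h
    · rw [h, map_zero]
    · rw [h, hπQ]
  -- the image of `s₁` on `W₀`: formal and even
  obtain ⟨x', y', hT', happ, h2'⟩ := exists_apply_eq_of_isogeny_of_odd lam₁ hodd₁ hP₁ hy₁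
  have hx' : HasRationalTwoTorsionX W₀ x' := hasRationalTwoTorsionX_of_nonsingular hT' h2'
  have hx'R : TwoTorsionRamifiedAtTwo x' :=
    (twoTorsionRamifiedAtTwo_iff_of_isogeny_apply_eq lam₁ hodd₁ hordV hP₁ hT' hy₁ happ).mp hs₁R
  have hx'O : ¬ TwoTorsionOdd W₀ x' := fun h ↦
    hs₁O ((twoTorsionOdd_iff_of_isogeny_apply_eq lam₁ hodd₁ hP₁ hT' hy₁ happ).mpr h)
  -- (T1): the rational 2-torsion of `W₀` is not unique
  have hnu : ¬ HasUniqueRationalTwoTorsionX W₀ x' := fun hu ↦ hx'O (hT1 x' hu hx'R)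
  have hother : ∃ b : ℚ, HasRationalTwoTorsionX W₀ b ∧ b ≠ x' := by
    by_contra hcon
    push Not at hcon
    exact hnu ⟨hx', fun z hz ↦ hcon z hz⟩
  obtain ⟨b, hb, hbx⟩ := hother
  exact SfPositions.exists_odd_etale_of_two_rat W₀ hord₀.1 hx' hb (Ne.symm hbx) hx'R hx'O

/-- **Instance `N = pq`, `p ≡ q ≡ 3 (mod 4)`** (the level of the newform = the habitat curve's conductor written as a product of two
distinct primes `≡ 3 (mod 4)`): the stub's conclusion from the prints and (T1) ALONE — (T2) is automatic because `(ℤ/pq)ˣ` has exponent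
`2 × odd`, so `[Λ_f : Λ₁(f)]` has 2-part ≤ 2 (`ShimuraExp.exists_odd_two_mul_nsmul_mem_periodLatticeGamma1`).  Covers e.g. the even-index
habitat levels 21, 33, 57, 129, 161, 681, 1457, 2513, 2537, 5561, 6609, … (memo Lines/star-even-structure-gen16.md).
[cite: Watkins2002, Lemma 3.1] [cite: Stevens1989, §2] [cite: GreenbergLNM1716, §5 Props. 5.13–5.14] -/
theorem starOptBSF_pq3_of_T1 (hnf : exists_isNewformOf) (hex : exists_optimal_gamma1ParametrizationData)
    (hU : Literature.NumberTheory.Automorphic.CalegariDimitrovTang2025_unboundedDenominators)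
    {p q' : ℕ} (hp : p.Prime) (hq' : q'.Prime) (hpq : p ≠ q') (hp4 : p % 4 = 3) (hq4 : q' % 4 = 3) [NeZero (p * q')] :
    ∀ (W : WeierstrassCurve ℚ) [W.IsElliptic] [W.IsGloballyMinimal] (x : ℚ), IsOrdinaryAt W 2 →
      HasUniqueRationalTwoTorsionX W x →
      ((TwoTorsionRamifiedAtTwo x ∧ ¬ TwoTorsionOdd W x) ∨ (TwoTorsionOdd W x ∧ ¬ TwoTorsionRamifiedAtTwo x)) →
      ∀ (f : CuspForm (CongruenceSubgroup.Gamma0 (p * q')) 2), IsNewformOf W f →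
      ∀ (W₀ : WeierstrassCurve ℚ) [W₀.IsElliptic] [W₀.IsGloballyMinimal], IsNewformOf W₀ f →
      ∀ (L₀ : PeriodPair), IsNeronLatticeOf (W₀.baseChange ℂ) L₀ → ∀ (q : ℚ), q ≠ 0 →
      (∀ z ∈ periodLattice f, (q : ℂ) * z ∈ L₀.lattice) → (∀ z ∈ L₀.lattice, ∃ w ∈ periodLattice f, z = (q : ℂ) * w) →
      (∀ x₀ : ℚ, HasUniqueRationalTwoTorsionX W₀ x₀ → TwoTorsionRamifiedAtTwo x₀ → TwoTorsionOdd W₀ x₀) →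
      ∃ x₀ : ℚ, HasRationalTwoTorsionX W₀ x₀ ∧ TwoTorsionOdd W₀ x₀ ∧ ¬ TwoTorsionRamifiedAtTwo x₀ := by
  intro W _ _ x hord hux htype f hW W₀ _ _ hW₀ L₀ hL₀ q hq hin hout hT1
  exact starOptBSF_of_shimuraExpTwo_of_T1 hnf hex hU W x hord hux htype f hW
    (ShimuraExp.exists_odd_two_mul_nsmul_mem_periodLatticeGamma1 hp hq' hpq hp4 hq4 f) W₀ hW₀ L₀ hL₀ q hq hin hout hT1

end Summit.BirchSwinnertonDyer.BirchSwinnertonDyer.Theorems.DepletionAtTwo.SfShimuraExp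

end
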